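/-
Copyright (c) 2026. All rights reserved.
Released under Apache 2.0 license as described in the file LICENSE.
-/
import Literature.NumberTheory.Automorphic.DefiniteMaximalOrdersTypeFibres
import Literature.NumberTheory.Automorphic.EichlerOrderLocalNormaliser
import HarnessLib

/-!
# The fibres of the type map `Cls O → Typ O` for the Eichler orders of a definite quaternion algebra over `ℚ`: right ideals
# with the same left order differ by a rational factor and a product of the two-sided ideals `𝔓_q` (`q ∣ N⁻`) and
# `𝔔_{p^e}` (`p^e ∥ N⁺`), so every fibre is an orbit of the Atkin–Lehner involutions `W_{q⁻}`, `W_{p⁺}`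
# (Voight Prop. 18.5.10 with (23.4.20); Vignéras III §5)

[tag: quaternion_algebra] [tag: class_number] [tag: eichler_order]

Topic `NumberTheory/Automorphic`; THEOREMS ONLY (no definition, no named fact, no instance; net Literature debt `0`).
Lane `lit-hodgefound`, seat p12, gen 51 — the Eichler-level sequel of `DefiniteMaximalOrdersTypeFibres.lean` (maximal orders),
for EVERY Brandt setup `S : XiSetup N⁺ N⁻` (Eichler orders `O = S.O` of level `N⁺` in the definite quaternion algebra of
discriminant `N⁻`), using the local normaliser of an Eichler order (`EichlerOrderLocalNormaliser.lean`, Voight Prop. 23.4.14)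
at the primes `p ∤ N⁻` and the ramified local structure at `q ∣ N⁻`.

THE PRINTED STATEMENTS. Voight, *Quaternion Algebras*, (23.4.20): for an Eichler order `O` of reduced discriminant `𝔑`,
`0 → Idl(R) → Idl(O) → ∏_{𝔭 ∣ 𝔑} ℤ/2ℤ → 0` (Prop. 23.4.14 at `𝔭 ∣ N⁺`, 23.3.19/18.1.3 at the ramified primes); Prop. 18.5.10
and 18.1.4: the fibre of `Cls O → Typ O` above the class of `O'` is in bijection with `PIdl(O') \ Idl(O')`, by `J' ↦ [J' I]`. In
the elementary form proved here (no `Idl`, `Pic`), with the admissible two-sided ideals `T = 𝔓_q` (`q ∣ N⁻`) and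
`T = 𝔔_{p^{v_p(N⁺)}}` (`p ∣ N⁺`):

* §2 **`XiSetup.exists_le_smul_or_exists_le_mul_twoSided_of_leftOrder_eq`** (the peeling step): right ideals `I' ⊊ I` with
  `O_L(I) = O_L(I')` satisfy `I' ⊆ ℓ I` for a prime `ℓ`, or `I' ⊆ I T` for an admissible `T` — at a prime `ℓ` where
  `I'₍ℓ₎ ≠ I₍ℓ₎`, `γ = α⁻¹α'` normalises `O₍ℓ₎`, so `γ O₍ℓ₎ ∈ {ℓ^k O₍ℓ₎, ℓ^k 𝔔₍ℓ₎}` (`ℓ ∤ N⁻`, Voight 23.4.14) or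
  `γ O₍ℓ₎ ∈ {ℓ^a O₍ℓ₎, ℓ^a 𝔓₍ℓ₎}` (`ℓ ∣ N⁻`, Vignéras II §1 Lemme 1.5);
* §3 **`XiSetup.exists_eq_smul_mul_prod_twoSided_of_leftOrder_eq_of_le`** / **`XiSetup.exists_smul_eq_smul_mul_prod_twoSided_of_leftOrder_eq`**:
  `O_L(I) = O_L(I')` ⟹ `m I' = c · I T₁ ⋯ T_s` with admissible `Tᵢ` (strong induction on `[I : I']`; `[I : I 𝔔] > 1` for
  `p ∣ N⁺` because `w ∉ O₍ₚ₎^×`);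
* §4 on classes: **`XiSetup.typeOf_eq_typeOf_iff_reflTransGen_atkinLehner`** — `typeOf c' = typeOf c` iff `c'` is obtained from
  `c` by a finite sequence of the involutions `W_{q⁻}` (`q ∣ N⁻`) and `W_{p⁺}` (`p ∤ N⁻`; the identity unless `p ∣ N⁺`): THE FIBRES
  OF THE TYPE MAP OF AN EICHLER ORDER ARE THE ORBITS OF ITS ATKIN–LEHNER INVOLUTIONS.

## References

* [Voight2021] J. Voight, *Quaternion Algebras*, GTM 288 (2021): Prop. 18.5.10, 18.1.4, Thm. 18.1.3, Prop. 23.4.14, (23.4.20),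
  Cor. 18.5.12, Lemma 17.4.13.
* [VignerasLNM800] M.-F. Vignéras, *Arithmétique des algèbres de quaternions*, LNM 800 (1980): Ch. I §4 Lemme 4.10, Ch. II §1
  Lemme 1.5, Ch. II §2 (ordres d'Eichler, normalisateur), Ch. III §5 (idéaux bilatères des ordres d'Eichler, exercice 5.8).

## Scope (honest)

Theorems only. Not here: the count of the orbits (Burnside over `(ℤ/2ℤ)^{ω(N⁺N⁻)}`) and the injectivity statement
`[Idl(O') : PIdl(O')]` for the orbit sizes.
-/

noncomputable section

open scoped Pointwise

universe u

namespace Literature.NumberTheory.Automorphic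

open AtkinLehner

namespace Brandt

variable {Nplus Nminus : ℕ} (S : XiSetup Nplus Nminus)

/-! ## §1 Elementary lemmas -/

/-- The algebra of a setup is a division algebra. [folklore] -/
private theorem XiSetup.hdivD₉ : ∀ x : S.D, x ≠ 0 → IsUnit x :=
  fun _ hx => isUnit_of_isTotallyDefinite S.D S.isTotallyDefinite hx

/-- The reduced norm of a unit is non-zero. [folklore] -/
private theorem reducedNorm_units_ne_zero₉ (u : S.Dˣ) : reducedNorm ℚ S.D (u : S.D) ≠ 0 :=
  (isUnit_iff_reducedNorm_ne_zero_holds ℚ S.D (u : S.D)).mp u.isUnit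

/-- A central unit `ν = q · 1 ∈ O₍ℓ₎` has `v_ℓ(q²) ≥ 0`. [folklore] -/
private theorem padicValRat_sq_nonneg_of_mem_localAt₉ {ℓ : ℕ} [Fact ℓ.Prime]
    {q : ℚ} {ν : S.Dˣ} (hν : (ν : S.D) = algebraMap ℚ S.D q) (hmem : (ν : S.D) ∈ localAt ℓ S.O) :
    0 ≤ padicValRat ℓ (q ^ 2) := by
  have h := (S.isZOrder_O.not_dvd_den_of_mem_localAt hmem).1
  rw [hν, reducedNorm_algebraMap] at h
  exact not_dvd_den_iff_padicValRat_nonneg.mp h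

/-- Translation by a unit is monotone on lattices. [folklore] -/
private theorem units_smul_mono₉ {B : Type u} [Ring B] (β : Bˣ) {I J : Submodule ℤ B} (h : I ≤ J) : β • I ≤ β • J := by
  intro x hx
  rw [mem_units_smul_submodule_iff] at hx ⊢
  exact h hx

/-- `m M ⊆ L` for a finitely generated `M` and a full lattice `L`. [folklore] -/
private theorem exists_natCast_smul_mem₉ {D : Type u} [AddCommGroup D] {M L : Submodule ℤ D} (hM : M.FG)
    (hL : ∀ d : D, ∃ n : ℤ, n ≠ 0 ∧ n • d ∈ L) : ∃ m : ℕ, m ≠ 0 ∧ ∀ x ∈ M, (m : ℤ) • x ∈ L := by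
  classical
  obtain ⟨s, hs⟩ := hM
  have hgen : ∀ x ∈ s, ∃ m : ℤ, m ≠ 0 ∧ m • x ∈ L := fun x _ => hL x
  choose! m hm0 hm using hgen
  refine ⟨(∏ x ∈ s, m x).natAbs, Int.natAbs_ne_zero.mpr (Finset.prod_ne_zero_iff.mpr hm0), ?_⟩
  intro x hx
  rw [← hs] at hx
  suffices hx' : (∏ x ∈ s, m x) • x ∈ L by
    rcases Int.natAbs_eq (∏ x ∈ s, m x) with h | h
    · rwa [← h]
    · rw [show ((∏ x ∈ s, m x).natAbs : ℤ) = -(∏ x ∈ s, m x) by omega, neg_smul]; exact L.neg_mem hx'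
  refine Submodule.span_induction (p := fun y _ => (∏ x ∈ s, m x) • y ∈ L) ?_ (by simp)
    (fun a b _ _ ha hb => by rw [smul_add]; exact L.add_mem ha hb)
    (fun c a _ ha => by rw [smul_comm]; exact L.smul_mem c ha) hx
  intro y hy
  rw [← Finset.prod_erase_mul _ _ hy, mul_smul]
  exact L.smul_mem _ (hm y hy)

/-- A central unit `ν = n · 1` acts as the integer `n`: `ν J = n J`. [folklore] -/
private theorem units_smul_eq_natCast_smul₉ {D : Type u} [Ring D] {ν : Dˣ} {n : ℕ} (hν : (ν : D) = (n : ℤ))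
    (J : Submodule ℤ D) : ν • J = (n : ℤ) • J := by
  ext x
  constructor
  · intro hx
    obtain ⟨y, hy, rfl⟩ := exists_eq_zsmul_of_mem_units_smul hν hx
    exact Submodule.smul_mem_pointwise_smul y _ J hy
  · intro hx
    obtain ⟨y, hy, rfl⟩ := (Submodule.mem_smul_pointwise_iff_exists x _ J).mp hx
    exact units_smul_eq_zsmul_of_val_eq hν J hy

/-- Left orders are unchanged by a central rescaling: `O_L(n I) = O_L(I)`. [folklore] -/
private theorem leftOrder_units_smul_of_val_eq_natCast₉ {D : Type u} [Ring D] {ν : Dˣ} {n : ℕ} (hν : (ν : D) = (n : ℤ))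
    (J : Submodule ℤ D) : leftOrder (ν • J) = leftOrder J := by
  rw [← leftOrderOf_eq_leftOrder, leftOrderOf_units_smul, leftOrderOf_eq_leftOrder]
  ext x
  rw [mem_units_smul_submodule_iff, mem_op_units_smul_submodule_iff, inv_inv, Units.smul_def, smul_eq_mul]
  have hc : x * (ν : D) = ν * x := by rw [hν]; exact ((Int.cast_commute (n : ℤ) x).eq).symm
  rw [mul_assoc, hc, Units.inv_mul_cancel_left]

/-- Equal lattices have equal classes. [folklore] -/
private theorem mk_congr₉ {I J : Submodule ℤ S.D} (hI : I ∈ rightIdeals S.O) (hJ : J ∈ rightIdeals S.O)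
    (h : I = J) : (Quotient.mk (rightClassSetoid S.O) ⟨I, hI⟩ : ClassSet S.O) = Quotient.mk (rightClassSetoid S.O) ⟨J, hJ⟩ := by
  subst h; rfl

/-- Classes of translates: `[α I] = [I]`. [folklore] -/
private theorem mk_units_smul_eq₉ (α : S.Dˣ) {I : Submodule ℤ S.D} (hI : I ∈ rightIdeals S.O)
    (hαI : α • I ∈ rightIdeals S.O) :
    (Quotient.mk (rightClassSetoid S.O) ⟨α • I, hαI⟩ : ClassSet S.O) = Quotient.mk (rightClassSetoid S.O) ⟨I, hI⟩ :=
  Quotient.sound ⟨α⁻¹, by simp [inv_smul_smul]⟩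

/-- Integer multiples of right ideals are right ideals. [folklore] -/
private theorem XiSetup.natCast_smul_mem₉ {n : ℕ} (hn : n ≠ 0) {I : Submodule ℤ S.D} (hI : I ∈ rightIdeals S.O) :
    (n : ℤ) • I ∈ rightIdeals S.O := by
  obtain ⟨ν, hν, -⟩ := exists_units_val_eq_natCast (D := S.D) hn
  rw [← units_smul_eq_natCast_smul₉ hν]
  exact S.mem_rightIdeals_of_isInvertibleRightIdeal (IsInvertibleRightIdeal.units_smul ν (S.isInvertibleRightIdeal_of_mem hI))

/-- Classes of integer multiples: `[n I] = [I]`. [folklore] -/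
private theorem mk_natCast_smul_eq₉ {n : ℕ} (hn : n ≠ 0) {I : Submodule ℤ S.D} (hI : I ∈ rightIdeals S.O)
    (hnI : (n : ℤ) • I ∈ rightIdeals S.O) :
    (Quotient.mk (rightClassSetoid S.O) ⟨(n : ℤ) • I, hnI⟩ : ClassSet S.O) = Quotient.mk (rightClassSetoid S.O) ⟨I, hI⟩ := by
  obtain ⟨ν, hν, -⟩ := exists_units_val_eq_natCast (D := S.D) hn
  have h : (n : ℤ) • I = ν • I := (units_smul_eq_natCast_smul₉ hν I).symm
  rw [mk_congr₉ S hnI (h ▸ hnI) h, mk_units_smul_eq₉ S ν hI]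

/-! ### Two lemmas on the level shape -/

/-- A level-shaped matrix has determinant of norm `≤ 1`. [folklore] -/
private theorem norm_det_le_one_of_isLevelShape {p : ℕ} [Fact p.Prime] {e : ℕ} {M : Matrix (Fin 2) (Fin 2) ℚ_[p]}
    (hM : IsLevelShape e M) : ‖M.det‖ ≤ 1 := by
  rw [Matrix.det_fin_two, sub_eq_add_neg]
  refine (Padic.nonarchimedean _ _).trans (max_le ?_ ?_)
  · rw [norm_mul]; exact mul_le_one₀ (hM.1 0 0) (norm_nonneg _) (hM.1 1 1)
  · rw [norm_neg, norm_mul]; exact mul_le_one₀ (hM.1 0 1) (norm_nonneg _) (hM.1 1 0)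

/-- For `e ≥ 1`, an Atkin–Lehner-shaped matrix with `‖det‖ = p^{-e}` has `‖W₀₁‖ = 1` (its determinant is carried by the
anti-diagonal). [folklore] -/
private theorem norm_apply_zero_one_eq_one {p : ℕ} [hp : Fact p.Prime] {e : ℕ} (he : 1 ≤ e) {W : Matrix (Fin 2) (Fin 2) ℚ_[p]}
    (hW : IsALShape e W) (hdet : ‖W.det‖ = (p : ℝ) ^ (-(e : ℤ))) : ‖W 0 1‖ = 1 := by
  set r := (p : ℝ) ^ (-(e : ℤ)) with hr
  have hp1 : (1 : ℝ) < p := by exact_mod_cast hp.out.one_lt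
  have hr0 : 0 < r := zpow_pos (by exact_mod_cast hp.out.pos) _
  have hr1 : r < 1 := zpow_lt_one_of_neg₀ hp1 (by omega)
  obtain ⟨h00, h01, h10, h11⟩ := hW
  refine le_antisymm h01 ?_
  by_contra hlt
  push Not at hlt
  have hdiag : ‖W 0 0 * W 1 1‖ < r := by
    rw [norm_mul]
    calc ‖W 0 0‖ * ‖W 1 1‖ ≤ r * r := mul_le_mul h00 h11 (norm_nonneg _) hr0.le
      _ < r * 1 := by gcongr
      _ = r := mul_one r
  have hanti : ‖-(W 0 1 * W 1 0)‖ < r := by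
    rw [norm_neg, norm_mul]
    calc ‖W 0 1‖ * ‖W 1 0‖ ≤ ‖W 0 1‖ * r := mul_le_mul_of_nonneg_left h10 (norm_nonneg _)
      _ < 1 * r := by gcongr
      _ = r := one_mul r
  have h : ‖W.det‖ < r := by
    rw [Matrix.det_fin_two, sub_eq_add_neg]
    exact (Padic.nonarchimedean _ _).trans_lt (max_lt hdiag hanti)
  exact h.ne hdet

/-! ## §2 The peeling step for an Eichler order -/

/-- **`I 𝔔 ≠ I` at a prime `p ∣ N⁺`** (`p ∤ N⁻`): locally `(I 𝔔)₍ₚ₎ = α w O₍ₚ₎` with `w ∉ O₍ₚ₎^×` (`‖nrd w‖_p = p^{-e} < 1`).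
[cite: Voight2021, Prop. 23.4.14] -/
theorem XiSetup.mul_atkinLehnerIdeal_ne_self {p : ℕ} [hpf : Fact p.Prime] (hp : ¬ p ∣ Nminus) (hpN : p ∣ Nplus)
    {I : Submodule ℤ S.D} (hI : I ∈ rightIdeals S.O) : I * atkinLehnerIdeal S.O (p ^ Nplus.factorization p) ≠ I := by
  have hO := S.isZOrder_O
  have he : 1 ≤ Nplus.factorization p :=
    Nat.pos_of_ne_zero fun h0 => by
      have := (Nat.factorization_eq_zero_iff Nplus p).mp h0
      rcases this with h | h | h
      · exact h hpf.out
      · exact h hpN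
      · exact S.nplus_ne_zero h
  obtain ⟨Φ, hΦ⟩ := S.exists_isLevelShape_iff S.nplus_ne_zero hp
  obtain ⟨w, hw, hW, hdet⟩ := exists_atkinLehner_generator Φ hO hΦ S.hdivD₉
  obtain ⟨α, hα, -⟩ := IsInvertibleRightIdeal.exists_localAt_leftOrderOf S.hdivD₉ hO (S.isInvertibleRightIdeal_of_mem hI) p
  intro heq
  have hloc : (α * w) • localAt p S.O = α • localAt p S.O := by
    rw [← localAt_mul_atkinLehnerIdeal_self Φ hO hΦ hα hw hW hdet, heq, hα]
  -- so `w⁻¹ ∈ O₍ₚ₎`, contradicting `‖det Φ(w⁻¹)‖ = p^e > 1`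
  have hmem : ((w⁻¹ : S.Dˣ) : S.D) ∈ localAt p S.O := by
    have h1 : (α : S.D) ∈ (α * w) • localAt p S.O := by
      rw [hloc, mem_units_smul_submodule_iff, Units.smul_def, smul_eq_mul, Units.inv_mul]
      exact le_localAt p S.O hO.one_mem
    rw [mem_units_smul_submodule_iff, Units.smul_def, smul_eq_mul, mul_inv_rev, Units.val_mul, mul_assoc,
      Units.inv_mul, mul_one] at h1
    exact h1
  have hshape := (hΦ _).mp hmem
  have hle := norm_det_le_one_of_isLevelShape hshape
  have hinv : Φ ((w⁻¹ : S.Dˣ) : S.D) = (Φ (w : S.D))⁻¹ :=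
    (Matrix.inv_eq_right_inv (by rw [← map_mul, Units.mul_inv, map_one])).symm
  rw [hinv, Matrix.det_nonsing_inv, Ring.inverse_eq_inv, norm_inv, hdet, ← zpow_neg, neg_neg] at hle
  have hp1 : (1 : ℝ) < p := by exact_mod_cast hpf.out.one_lt
  have hgt : (1 : ℝ) < (p : ℝ) ^ ((Nplus.factorization p : ℕ) : ℤ) := one_lt_zpow₀ hp1 (by omega)
  exact absurd hle (not_le.mpr hgt)

/-- **The peeling step for an Eichler order.** For right ideals `I' ⊊ I` of `O` (Eichler of level `N⁺` in the definite
quaternion algebra of discriminant `N⁻`) with the same left order, either `I' ⊆ ℓ I` for a prime `ℓ`, or `I' ⊆ I 𝔓_q` for a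
prime `q ∣ N⁻`, or `I' ⊆ I 𝔔_{p^{v_p(N⁺)}}` for a prime `p ∣ N⁺` (`p ∤ N⁻`): at a prime `ℓ` with `I'₍ℓ₎ ≠ I₍ℓ₎` the element
`γ = α⁻¹ α'` (`I₍ℓ₎ = α O₍ℓ₎`, `I'₍ℓ₎ = α' O₍ℓ₎`) normalises `O₍ℓ₎`, so `γ O₍ℓ₎` is `ℓ^k O₍ℓ₎` or `ℓ^k 𝔔₍ℓ₎` (Voight 23.4.14,
`ℓ ∤ N⁻`) or `ℓ^a O₍ℓ₎`, `ℓ^a 𝔓₍ℓ₎` (`ℓ ∣ N⁻`). [cite: Voight2021, Prop. 23.4.14, (23.4.20) and Prop. 18.5.10] [cite: VignerasLNM800, Ch. II §1 Lemme 1.5 and Ch. II §2] -/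
theorem XiSetup.exists_le_smul_or_exists_le_mul_twoSided_of_leftOrder_eq {I I' : Submodule ℤ S.D} (hI : I ∈ rightIdeals S.O)
    (hI' : I' ∈ rightIdeals S.O) (hL : leftOrder I = leftOrder I') (hle : I' ≤ I) (hne : I' ≠ I) :
    (∃ ℓ : ℕ, ℓ.Prime ∧ I' ≤ (ℓ : ℤ) • I) ∨
      (∃ q : ℕ, q.Prime ∧ q ∣ Nminus ∧ I' ≤ I * normPrimeIdeal S.O q) ∨
      (∃ p : ℕ, p.Prime ∧ ¬ p ∣ Nminus ∧ p ∣ Nplus ∧ I' ≤ I * atkinLehnerIdeal S.O (p ^ Nplus.factorization p)) := by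
  have hO := S.isZOrder_O
  have hIi := S.isInvertibleRightIdeal_of_mem hI
  have hI'i := S.isInvertibleRightIdeal_of_mem hI'
  -- a prime where the localisations differ
  obtain ⟨ℓ, hℓ, hneℓ⟩ : ∃ ℓ : ℕ, ℓ.Prime ∧ localAt ℓ I' ≠ localAt ℓ I := by
    by_contra h
    push Not at h
    exact hne (eq_iff_forall_prime_localAt_eq.mpr h)
  haveI : Fact ℓ.Prime := ⟨hℓ⟩
  have hℓ1 : (1 : ℝ) < ℓ := by exact_mod_cast hℓ.one_lt
  obtain ⟨α, hα, hαL⟩ := IsInvertibleRightIdeal.exists_localAt_leftOrderOf S.hdivD₉ hO hIi ℓ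
  obtain ⟨α', hα', hα'L⟩ := IsInvertibleRightIdeal.exists_localAt_leftOrderOf S.hdivD₉ hO hI'i ℓ
  set Λ := localAt ℓ S.O with hΛdef
  have h1 : (1 : S.D) ∈ Λ := le_localAt ℓ S.O hO.one_mem
  have hmul : ∀ a ∈ Λ, ∀ b ∈ Λ, a * b ∈ Λ :=
    fun a ha b hb => Literature.NumberTheory.Automorphic.mul_mem_localAt hO.mul_mem ℓ ha hb
  have hLL : α • (MulOpposite.op ((α⁻¹ : S.Dˣ) : S.D) • Λ) = α' • (MulOpposite.op ((α'⁻¹ : S.Dˣ) : S.D) • Λ) := by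
    rw [← hαL, ← hα'L, leftOrderOf_eq_leftOrder, leftOrderOf_eq_leftOrder, hL]
  set γ : S.Dˣ := α⁻¹ * α' with hγdef
  -- `γ` conjugates `Λ` into itself
  have hγ : ∀ x ∈ Λ, (γ : S.D) * x * ((γ⁻¹ : S.Dˣ) : S.D) ∈ Λ := by
    intro x hx
    have hx' : (α' : S.D) * x * ((α'⁻¹ : S.Dˣ) : S.D) ∈ α' • (MulOpposite.op ((α'⁻¹ : S.Dˣ) : S.D) • Λ) := by
      rw [mem_units_smul_submodule_iff, mem_op_units_smul_submodule_iff, inv_inv, Units.smul_def, smul_eq_mul]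
      simpa [mul_assoc] using hx
    rw [← hLL, mem_units_smul_submodule_iff, mem_op_units_smul_submodule_iff, inv_inv, Units.smul_def, smul_eq_mul] at hx'
    rw [hγdef, mul_inv_rev, inv_inv, Units.val_mul, Units.val_mul]
    simpa [mul_assoc] using hx'
  -- and `γ Λ ⊆ Λ`
  have hγle : γ • Λ ≤ Λ := by
    intro x hx
    rw [mem_units_smul_submodule_iff, hγdef, mul_inv_rev, inv_inv, Units.smul_def, Units.val_mul, smul_eq_mul,
      mul_assoc] at hx
    have h2 : (α : S.D) * x ∈ α' • Λ := by
      rw [mem_units_smul_submodule_iff, Units.smul_def, smul_eq_mul]; exact hx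
    rw [← hα'] at h2
    have h3 := (localAt_mono ℓ hle) h2
    rw [hα, mem_units_smul_submodule_iff, Units.smul_def, smul_eq_mul, Units.inv_mul_cancel_left] at h3
    exact h3
  -- `I'₍ℓ₎ = α γ Λ`
  have hI'loc : localAt ℓ I' = α • (γ • Λ) := by
    rw [hα', hγdef, ← mul_smul, mul_inv_cancel_left]
  -- the central case, used twice: `γ Λ = ν Λ`, `ν = ℓ^k`
  have central : ∀ (k : ℤ) (ν : S.Dˣ), (ν : S.D) = algebraMap ℚ S.D ((ℓ : ℚ) ^ k) → (∀ β : S.Dˣ, β * ν = ν * β) →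
      γ • Λ = ν • Λ → ∃ ℓ' : ℕ, ℓ'.Prime ∧ I' ≤ (ℓ' : ℤ) • I := by
    intro k ν hν hνc hA
    refine ⟨ℓ, hℓ, ?_⟩
    have hνmem : (ν : S.D) ∈ Λ := by
      apply hγle; rw [hA, mem_units_smul_submodule_iff, Units.smul_def, smul_eq_mul, Units.inv_mul]; exact h1
    have hk0 : 0 ≤ k := by
      have h := padicValRat_sq_nonneg_of_mem_localAt₉ S hν hνmem
      rw [← zpow_natCast, ← zpow_mul, padicValRat.zpow, padicValRat.self hℓ.one_lt] at h
      simp only [Nat.cast_ofNat, mul_one] at h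
      omega
    have hk1 : 1 ≤ k := by
      by_contra hlt
      have hν1 : ν = 1 := Units.ext (by rw [hν, show k = 0 by omega, zpow_zero, map_one, Units.val_one])
      apply hneℓ
      rw [hI'loc, hA, hν1, one_smul, hα]
    refine S.le_natCast_smul_of_localAt_le hle hℓ hk1 hν ?_
    rw [hI'loc, hA, hα, ← mul_smul, hνc, mul_smul]
  by_cases hℓN : ℓ ∣ Nminus
  · -- a ramified prime: as for maximal orders
    have hdivℓ := S.hdiv_of_dvd hℓN
    have hOℓ := S.maximalAt_of_dvd hℓN
    obtain ⟨a, ν, hν, hνc, hcase⟩ :=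
      exists_units_smul_localAt_eq_central_of_ramified hOℓ (S.hnt_of_dvd hℓN) hdivℓ hO γ
    rcases hcase with hA | hB
    · rw [← hΛdef] at hA
      exact Or.inl (central a ν hν hνc hA)
    · obtain ⟨u, hu, hup⟩ := exists_uniformiser (O := S.O) hdivℓ hO
      have hPu : localAt ℓ (normPrimeIdeal S.O ℓ) = u • Λ := localAt_normPrimeIdeal_eq_units_smul hdivℓ hOℓ hO hu hup
      have huΛ : (u : S.D) ∈ Λ := le_localAt ℓ S.O (normPrimeIdeal_le S.O ℓ hu)
      rw [hPu, ← hΛdef] at hB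
      have hνu : (ν : S.D) * u ∈ Λ := by
        apply hγle
        rw [hB, ← mul_smul, mem_units_smul_submodule_iff, Units.smul_def, smul_eq_mul, ← Units.val_mul, Units.inv_mul]
        exact h1
      have ha0 : 0 ≤ a := by
        have h := (hO.not_dvd_den_of_mem_localAt hνu).1
        rw [not_dvd_den_iff_padicValRat_nonneg, reducedNorm_mul_holds ℚ S.D,
          padicValRat.mul (reducedNorm_units_ne_zero₉ S _) (reducedNorm_units_ne_zero₉ S _),
          padicValRat_reducedNorm_uniformiser hOℓ hdivℓ hO hu hup, hν, reducedNorm_algebraMap, ← zpow_natCast,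
          ← zpow_mul, padicValRat.zpow, padicValRat.self hℓ.one_lt] at h
        simp only [Nat.cast_ofNat, mul_one] at h
        omega
      rcases eq_or_lt_of_le ha0 with ha | ha
      · -- `a = 0`: `I' ⊆ I 𝔓_ℓ`
        right; left
        refine ⟨ℓ, hℓ, hℓN, ?_⟩
        have hν1 : (ν : S.D) = 1 := by rw [hν, ← ha, zpow_zero, map_one]
        have hν1' : ν = 1 := Units.ext hν1
        rw [hν1', one_smul] at hB
        have hIP : localAt ℓ (I * normPrimeIdeal S.O ℓ) = (α * u) • Λ :=
          localAt_mul_normPrimeIdeal_self hdivℓ hOℓ hO hα hu hup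
        intro y hy
        refine mem_of_forall_prime_mem_localAt fun q hq => ?_
        by_cases hqℓ : q = ℓ
        · subst hqℓ
          rw [hIP, mul_smul, ← hB, ← hI'loc]
          exact le_localAt q I' hy
        · rw [localAt_mul_normPrimeIdeal_of_ne hO hIi hq hqℓ]
          exact le_localAt q I (hle hy)
      · -- `a ≥ 1`: `I' ⊆ ℓ I`
        left
        refine ⟨ℓ, hℓ, S.le_natCast_smul_of_localAt_le hle hℓ (by omega) hν ?_⟩
        rw [hI'loc, hB, hα, ← mul_smul α ν, hνc α, mul_smul]
        refine units_smul_mono₉ ν (units_smul_mono₉ α fun x hx => ?_)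
        rw [mem_units_smul_submodule_iff, Units.smul_def, smul_eq_mul] at hx
        have := hmul _ huΛ _ hx
        rwa [Units.mul_inv_cancel_left] at this
  · -- a prime `ℓ ∤ N⁻`: level model of exponent `e = v_ℓ(N⁺)` and the local normaliser (Voight 23.4.14)
    set e := Nplus.factorization ℓ with hedef
    obtain ⟨Φ, hΦ⟩ := S.exists_isLevelShape_iff S.nplus_ne_zero hℓN
    obtain ⟨w, hw, hW, hdet⟩ := exists_atkinLehner_generator Φ hO hΦ S.hdivD₉
    obtain ⟨k, ν, hν, hνc, hcase⟩ := exists_units_smul_eq_central_or_atkinLehner_of_conj_le Φ hΦ γ hγ hW hdet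
    rw [← hΛdef] at hcase
    rcases hcase with hA | hB
    · exact Or.inl (central k ν hν hνc hA)
    · -- `γ Λ = ν (w Λ) = ν 𝔔₍ℓ₎`
      have hQ : w • Λ = localAt ℓ (atkinLehnerIdeal S.O (ℓ ^ e)) := by
        rw [hΛdef, localAt_atkinLehnerIdeal_eq_units_smul Φ hO hΦ hw hW hdet]
      by_cases hℓNp : ℓ ∣ Nplus
      · -- `ℓ ∣ N⁺`: `e ≥ 1`
        have he : 1 ≤ e :=
          Nat.pos_of_ne_zero fun h0 => by
            rcases (Nat.factorization_eq_zero_iff Nplus ℓ).mp h0 with h | h | h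
            · exact h hℓ
            · exact h hℓNp
            · exact S.nplus_ne_zero h
        -- `k ≥ 0`: `ν w ∈ Λ` and `‖Φ(w)₀₁‖ = 1`
        have hνw : (ν : S.D) * w ∈ Λ := by
          apply hγle
          rw [hB, ← mul_smul, mem_units_smul_submodule_iff, Units.smul_def, smul_eq_mul, ← Units.val_mul, Units.inv_mul]
          exact h1
        have hq0 : ((ℓ : ℚ) ^ k) ≠ 0 := zpow_ne_zero _ (by exact_mod_cast hℓ.ne_zero)
        have hΦν : Φ (ν : S.D) = algebraMap ℚ_[ℓ] _ (((ℓ : ℚ_[ℓ]) ^ k)) := by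
          rw [hν, AlgHom.commutes, IsScalarTower.algebraMap_apply ℚ ℚ_[ℓ] (Matrix (Fin 2) (Fin 2) ℚ_[ℓ]), map_zpow₀,
            map_natCast]
        have hk0 : 0 ≤ k := by
          have hsh := (hΦ _).mp hνw
          have h01 := hsh.1 0 1
          rw [map_mul, hΦν, Algebra.algebraMap_eq_smul_one, smul_mul_assoc, one_mul, Matrix.smul_apply, smul_eq_mul,
            norm_mul, norm_apply_zero_one_eq_one he hW hdet, mul_one, Padic.norm_p_zpow] at h01
          by_contra hlt
          push Not at hlt
          have : (1 : ℝ) < (ℓ : ℝ) ^ (-k) := one_lt_zpow₀ hℓ1 (by omega)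
          exact absurd h01 (not_le.mpr this)
        rcases eq_or_lt_of_le hk0 with hk | hk
        · -- `k = 0`: `I'₍ℓ₎ = (I 𝔔)₍ℓ₎`, so `I' ⊆ I 𝔔`
          right; right
          refine ⟨ℓ, hℓ, hℓN, hℓNp, ?_⟩
          have hν1 : ν = 1 := Units.ext (by rw [hν, ← hk, zpow_zero, map_one, Units.val_one])
          rw [hν1, one_smul] at hB
          have hIQ : localAt ℓ (I * atkinLehnerIdeal S.O (ℓ ^ e)) = (α * w) • Λ :=
            localAt_mul_atkinLehnerIdeal_self Φ hO hΦ hα hw hW hdet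
          intro y hy
          refine mem_of_forall_prime_mem_localAt fun q hq => ?_
          by_cases hqℓ : q = ℓ
          · subst hqℓ
            rw [hIQ, mul_smul, ← hB, ← hI'loc]
            exact le_localAt q I' hy
          · rw [localAt_mul_atkinLehnerIdeal_of_coprime hO (pow_ne_zero _ hℓ.ne_zero) hIi
              (((Nat.coprime_primes hℓ hq).mpr (Ne.symm hqℓ)).pow_left e)]
            exact le_localAt q I (hle hy)
        · -- `k ≥ 1`: `I' ⊆ ℓ I` (`𝔔₍ℓ₎ ⊆ Λ`)
          left
          refine ⟨ℓ, hℓ, S.le_natCast_smul_of_localAt_le hle hℓ (by omega) hν ?_⟩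
          rw [hI'loc, hB, hα, ← mul_smul α ν, hνc α, mul_smul]
          refine units_smul_mono₉ ν (units_smul_mono₉ α ?_)
          rw [hQ]
          exact localAt_mono ℓ (atkinLehnerIdeal_le S.O _)
      · -- `ℓ ∤ N⁺`: `e = 0`, `𝔔_1 = O`, so `γ Λ = ν Λ` again
        have he0 : e = 0 := by rw [hedef]; exact Nat.factorization_eq_zero_of_not_dvd hℓNp
        have hQO : localAt ℓ (atkinLehnerIdeal S.O (ℓ ^ e)) = Λ := by rw [he0, pow_zero, atkinLehnerIdeal_one hO]
        rw [hQ, hQO] at hB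
        exact Or.inl (central k ν hν hνc hB)

/-! ## §3 Right ideals with the same left order: `m I' = c · I T₁ ⋯ T_s` -/

/-- **`I T₁ ⋯ T_s` is a right `O`-ideal** for admissible two-sided ideals `Tᵢ ∈ {𝔓_q (q ∣ N⁻), 𝔔_{p^{v_p N⁺}} (p ∤ N⁻)}`.
[cite: VignerasLNM800, Ch. II §1 Cor. 1.7 and Ch. II §2] -/
theorem XiSetup.mul_prod_twoSided_mem {I : Submodule ℤ S.D} (hI : I ∈ rightIdeals S.O) {L : List (Submodule ℤ S.D)}
    (hL : ∀ T ∈ L, (∃ q : ℕ, q.Prime ∧ q ∣ Nminus ∧ T = normPrimeIdeal S.O q) ∨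
      (∃ p : ℕ, p.Prime ∧ ¬ p ∣ Nminus ∧ T = atkinLehnerIdeal S.O (p ^ Nplus.factorization p))) :
    I * L.prod ∈ rightIdeals S.O := by
  induction L generalizing I with
  | nil => simpa using hI
  | cons T L ih =>
    rw [List.prod_cons, ← mul_assoc]
    refine ih ?_ fun T' hT' => hL T' (List.mem_cons_of_mem T hT')
    rcases hL T (by simp) with ⟨q, hq, hqN, rfl⟩ | ⟨p, hp, hpN, rfl⟩
    · haveI : Fact q.Prime := ⟨hq⟩
      exact S.mul_normPrimeIdeal_mem_of_dvd hqN hI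
    · haveI : Fact p.Prime := ⟨hp⟩
      exact S.mul_atkinLehnerIdeal_mem hpN hI

/-- **`O_L(I T₁ ⋯ T_s) = O_L(I)`**: the admissible two-sided ideals normalise the left orders. [cite: Voight2021, (23.4.20) and Lemma 17.4.11] -/
theorem XiSetup.leftOrder_mul_prod_twoSided {I : Submodule ℤ S.D} (hI : I ∈ rightIdeals S.O) {L : List (Submodule ℤ S.D)}
    (hL : ∀ T ∈ L, (∃ q : ℕ, q.Prime ∧ q ∣ Nminus ∧ T = normPrimeIdeal S.O q) ∨
      (∃ p : ℕ, p.Prime ∧ ¬ p ∣ Nminus ∧ T = atkinLehnerIdeal S.O (p ^ Nplus.factorization p))) :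
    leftOrder (I * L.prod) = leftOrder I := by
  induction L generalizing I with
  | nil => simp
  | cons T L ih =>
    rw [List.prod_cons, ← mul_assoc]
    have hL' : ∀ T' ∈ L, _ := fun T' hT' => hL T' (List.mem_cons_of_mem T hT')
    rcases hL T (by simp) with ⟨q, hq, hqN, rfl⟩ | ⟨p, hp, hpN, rfl⟩
    · haveI : Fact q.Prime := ⟨hq⟩
      rw [ih (S.mul_normPrimeIdeal_mem_of_dvd hqN hI) hL', S.leftOrder_mul_normPrimeIdeal_of_dvd hqN hI]
    · haveI : Fact p.Prime := ⟨hp⟩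
      rw [ih (S.mul_atkinLehnerIdeal_mem hpN hI) hL', S.leftOrder_mul_atkinLehnerIdeal hpN hI]

/-- **Right ideals with the same left order, nested case** (Eichler orders): if `I' ⊆ I` are right ideals of `O` with
`O_L(I) = O_L(I')`, then `I' = c · I T₁ ⋯ T_s` for a positive integer `c` and admissible two-sided ideals
`Tᵢ ∈ {𝔓_q : q ∣ N⁻} ∪ {𝔔_{p^{v_p N⁺}} : p ∣ N⁺}` — by strong induction on `[I : I']` with the peeling step (`[I : I 𝔓_q] = q²`,
`[I : I 𝔔] > 1`). [cite: Voight2021, Prop. 18.5.10 and (23.4.20)] -/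
theorem XiSetup.exists_eq_smul_mul_prod_twoSided_of_leftOrder_eq_of_le {I I' : Submodule ℤ S.D} (hI : I ∈ rightIdeals S.O)
    (hI' : I' ∈ rightIdeals S.O) (hL : leftOrder I = leftOrder I') (hle : I' ≤ I) :
    ∃ c : ℕ, c ≠ 0 ∧ ∃ L : List (Submodule ℤ S.D),
      (∀ T ∈ L, (∃ q : ℕ, q.Prime ∧ q ∣ Nminus ∧ T = normPrimeIdeal S.O q) ∨
        (∃ p : ℕ, p.Prime ∧ ¬ p ∣ Nminus ∧ T = atkinLehnerIdeal S.O (p ^ Nplus.factorization p))) ∧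
      I' = (c : ℤ) • (I * L.prod) := by
  have hO := S.isZOrder_O
  haveI : IsAddTorsionFree S.D := S.isAddTorsionFree
  suffices key : ∀ (d : ℕ) {I I' : Submodule ℤ S.D}, I ∈ rightIdeals S.O → I' ∈ rightIdeals S.O →
      leftOrder I = leftOrder I' → I' ≤ I → I'.toAddSubgroup.relIndex I.toAddSubgroup = d →
      ∃ c : ℕ, c ≠ 0 ∧ ∃ L : List (Submodule ℤ S.D),
        (∀ T ∈ L, (∃ q : ℕ, q.Prime ∧ q ∣ Nminus ∧ T = normPrimeIdeal S.O q) ∨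
          (∃ p : ℕ, p.Prime ∧ ¬ p ∣ Nminus ∧ T = atkinLehnerIdeal S.O (p ^ Nplus.factorization p))) ∧
        I' = (c : ℤ) • (I * L.prod) from
    key _ hI hI' hL hle rfl
  intro d
  induction d using Nat.strong_induction_on with
  | _ d ih =>
  intro I I' hI hI' hL hle hd
  have hIi := S.isInvertibleRightIdeal_of_mem hI
  have hd0 : d ≠ 0 := by
    obtain ⟨m, hm0, hm⟩ := exists_natCast_smul_mem₉ hI.1.1 hI'.1.2
    rw [← hd]
    exact relIndex_ne_zero_of_smul_mem I hI.1.1 (by exact_mod_cast hm0 : (m : ℤ) ≠ 0) I' hm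
  by_cases heq : I' = I
  · exact ⟨1, one_ne_zero, [], by simp, by rw [heq, Nat.cast_one, one_smul, List.prod_nil, mul_one]⟩
  -- the generic index step: `I' ⊆ J ⊊ I`, `J` a right ideal with the same left order, gives the claim for `I'`
  have step : ∀ {J : Submodule ℤ S.D} (T : Submodule ℤ S.D), J = I * T → J ∈ rightIdeals S.O → leftOrder J = leftOrder I →
      J ≤ I → J ≠ I → I' ≤ J →
      ((∃ q : ℕ, q.Prime ∧ q ∣ Nminus ∧ T = normPrimeIdeal S.O q) ∨
        (∃ p : ℕ, p.Prime ∧ ¬ p ∣ Nminus ∧ T = atkinLehnerIdeal S.O (p ^ Nplus.factorization p))) →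
      ∃ c : ℕ, c ≠ 0 ∧ ∃ L : List (Submodule ℤ S.D),
        (∀ T ∈ L, (∃ q : ℕ, q.Prime ∧ q ∣ Nminus ∧ T = normPrimeIdeal S.O q) ∨
          (∃ p : ℕ, p.Prime ∧ ¬ p ∣ Nminus ∧ T = atkinLehnerIdeal S.O (p ^ Nplus.factorization p))) ∧
        I' = (c : ℤ) • (I * L.prod) := by
    intro J T hJT hJ hLJ hJle hJne hI'J hT
    have hJidx0 : J.toAddSubgroup.relIndex I.toAddSubgroup ≠ 0 := by
      obtain ⟨m, hm0, hm⟩ := exists_natCast_smul_mem₉ hI.1.1 hJ.1.2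
      exact relIndex_ne_zero_of_smul_mem I hI.1.1 (by exact_mod_cast hm0 : (m : ℤ) ≠ 0) J hm
    have hJidx1 : J.toAddSubgroup.relIndex I.toAddSubgroup ≠ 1 := by
      intro h1
      apply hJne
      exact le_antisymm hJle (AddSubgroup.relIndex_eq_one.mp h1)
    have hmul := AddSubgroup.relIndex_mul_relIndex (H := I'.toAddSubgroup) (K := J.toAddSubgroup) (L := I.toAddSubgroup)
      hI'J hJle
    rw [hd] at hmul
    have hlt : I'.toAddSubgroup.relIndex J.toAddSubgroup < d := by
      have h2 : 2 ≤ J.toAddSubgroup.relIndex I.toAddSubgroup := by omega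
      have hpos : 0 < I'.toAddSubgroup.relIndex J.toAddSubgroup := by
        rcases Nat.eq_zero_or_pos (I'.toAddSubgroup.relIndex J.toAddSubgroup) with h | h
        · rw [h, zero_mul] at hmul; exact absurd hmul.symm hd0
        · exact h
      nlinarith
    obtain ⟨c, hc, L, hLq, h⟩ := ih _ hlt hJ hI' (hLJ.trans hL) hI'J rfl
    refine ⟨c, hc, T :: L, ?_, ?_⟩
    · intro T' hT'
      rcases List.mem_cons.mp hT' with rfl | hT'
      · exact hT
      · exact hLq T' hT'
    · rw [h, hJT, List.prod_cons, mul_assoc]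
  rcases S.exists_le_smul_or_exists_le_mul_twoSided_of_leftOrder_eq hI hI' hL hle heq with
    ⟨ℓ, hℓ, hI'ℓ⟩ | ⟨q, hq, hqN, hI'P⟩ | ⟨p, hp, hpN, hpNp, hI'Q⟩
  · -- `I' ⊆ ℓ I`: divide by `ℓ`
    obtain ⟨ν, hν, hνc⟩ := exists_units_val_eq_natCast (D := S.D) hℓ.ne_zero
    set I'' : Submodule ℤ S.D := ν⁻¹ • I' with hI''def
    have hI''mem : I'' ∈ rightIdeals S.O :=
      S.mem_rightIdeals_of_isInvertibleRightIdeal (IsInvertibleRightIdeal.units_smul ν⁻¹ (S.isInvertibleRightIdeal_of_mem hI'))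
    have hνI'' : I' = ν • I'' := by rw [hI''def, smul_inv_smul]
    have hI'eq : I' = (ℓ : ℤ) • I'' := by rw [hνI'', units_smul_eq_natCast_smul₉ hν]
    have hI''le : I'' ≤ I := by
      intro x hx
      rw [hI''def, mem_units_smul_submodule_iff, inv_inv] at hx
      have h1 : (ℓ : ℤ) • x ∈ (ℓ : ℤ) • I := by
        have : ν • x = (ℓ : ℤ) • x := by rw [Units.smul_def, smul_eq_mul, hν, zsmul_eq_mul]
        rw [← this]; exact hI'ℓ hx
      obtain ⟨y, hy, hxy⟩ := (Submodule.mem_smul_pointwise_iff_exists _ _ I).mp h1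
      have hℓ0 : ((ℓ : ℤ) : ℚ) ≠ 0 := by exact_mod_cast hℓ.ne_zero
      have : x = y := by
        apply smul_right_injective S.D hℓ0
        show ((ℓ : ℤ) : ℚ) • x = ((ℓ : ℤ) : ℚ) • y
        rw [Int.cast_smul_eq_zsmul, Int.cast_smul_eq_zsmul]; exact hxy.symm
      rw [this]; exact hy
    have hLI'' : leftOrder I'' = leftOrder I' := by
      rw [hνI'', leftOrder_units_smul_of_val_eq_natCast₉ hν]
    have hI'le'' : I' ≤ I'' := by
      rw [hI'eq]; intro x hx
      obtain ⟨y, hy, rfl⟩ := (Submodule.mem_smul_pointwise_iff_exists x _ I'').mp hx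
      exact I''.smul_mem _ hy
    have hidx : I'.toAddSubgroup.relIndex I''.toAddSubgroup = ℓ ^ 4 := by
      rw [hI'eq]; exact relIndex_natCast_smul_eq_pow_four hI''mem.1 hℓ.ne_zero
    have hmul := AddSubgroup.relIndex_mul_relIndex (H := I'.toAddSubgroup) (K := I''.toAddSubgroup) (L := I.toAddSubgroup)
      hI'le'' hI''le
    rw [hidx, hd] at hmul
    have hlt : I''.toAddSubgroup.relIndex I.toAddSubgroup < d := by
      have h4 : 1 < ℓ ^ 4 := Nat.one_lt_pow (by norm_num) hℓ.one_lt
      have hpos : 0 < I''.toAddSubgroup.relIndex I.toAddSubgroup := by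
        rcases Nat.eq_zero_or_pos (I''.toAddSubgroup.relIndex I.toAddSubgroup) with h | h
        · rw [h, mul_zero] at hmul; exact absurd hmul.symm hd0
        · exact h
      nlinarith
    obtain ⟨c, hc, L, hLq, h⟩ := ih _ hlt hI hI''mem (hL.trans hLI''.symm) hI''le rfl
    refine ⟨ℓ * c, mul_ne_zero hℓ.ne_zero hc, L, hLq, ?_⟩
    rw [hI'eq, h, smul_smul]; norm_cast
  · -- `I' ⊆ I 𝔓_q`
    haveI : Fact q.Prime := ⟨hq⟩
    have hJ : I * normPrimeIdeal S.O q ∈ rightIdeals S.O := S.mul_normPrimeIdeal_mem_of_dvd hqN hI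
    refine step (normPrimeIdeal S.O q) rfl hJ (S.leftOrder_mul_normPrimeIdeal_of_dvd hqN hI) (mul_normPrimeIdeal_le hIi)
      (fun heq' => ?_) hI'P (Or.inl ⟨q, hq, hqN, rfl⟩)
    -- `[I : I 𝔓_q] = q² ≠ 1`
    have hidx : (I * normPrimeIdeal S.O q).toAddSubgroup.relIndex I.toAddSubgroup = q ^ 2 :=
      relIndex_mul_normPrimeIdeal (S.hdiv_of_dvd hqN) (S.maximalAt_of_dvd hqN) hO hIi
    rw [heq', AddSubgroup.relIndex_self] at hidx
    have : 1 < q ^ 2 := Nat.one_lt_pow (by norm_num) hq.one_lt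
    omega
  · -- `I' ⊆ I 𝔔_{p^e}`
    haveI : Fact p.Prime := ⟨hp⟩
    have hJ : I * atkinLehnerIdeal S.O (p ^ Nplus.factorization p) ∈ rightIdeals S.O := S.mul_atkinLehnerIdeal_mem hpN hI
    exact step (atkinLehnerIdeal S.O (p ^ Nplus.factorization p)) rfl hJ (S.leftOrder_mul_atkinLehnerIdeal hpN hI)
      (mul_atkinLehnerIdeal_le hIi) (S.mul_atkinLehnerIdeal_ne_self hpN hpNp hI) hI'Q (Or.inr ⟨p, hp, hpN, rfl⟩)

/-- **Right ideals with the same left order** (Eichler orders of a definite quaternion algebra over `ℚ`): `O_L(I) = O_L(I')` ⟹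
`m I' = c · I T₁ ⋯ T_s` for positive integers `m, c` and admissible two-sided ideals `Tᵢ` — the two-sided `O_L(I)`-ideal
`I' I⁻¹` is a rational multiple of a product of the primes above `q ∣ N⁻` and the Atkin–Lehner ideals above `p ∣ N⁺`
(Voight (23.4.20): `Idl(O)/Idl(ℤ) ≃ ∏_{p ∣ N} ℤ/2ℤ`). [cite: Voight2021, Prop. 18.5.10 and (23.4.20)] [cite: VignerasLNM800, Ch. I §4 Lemme 4.10 and Ch. III §5] -/
theorem XiSetup.exists_smul_eq_smul_mul_prod_twoSided_of_leftOrder_eq {I I' : Submodule ℤ S.D} (hI : I ∈ rightIdeals S.O)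
    (hI' : I' ∈ rightIdeals S.O) (hL : leftOrder I = leftOrder I') :
    ∃ m c : ℕ, m ≠ 0 ∧ c ≠ 0 ∧ ∃ L : List (Submodule ℤ S.D),
      (∀ T ∈ L, (∃ q : ℕ, q.Prime ∧ q ∣ Nminus ∧ T = normPrimeIdeal S.O q) ∨
        (∃ p : ℕ, p.Prime ∧ ¬ p ∣ Nminus ∧ T = atkinLehnerIdeal S.O (p ^ Nplus.factorization p))) ∧
      (m : ℤ) • I' = (c : ℤ) • (I * L.prod) := by
  obtain ⟨m, hm0, hm⟩ := exists_natCast_smul_mem₉ hI'.1.1 hI.1.2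
  obtain ⟨ν, hν, hνc⟩ := exists_units_val_eq_natCast (D := S.D) hm0
  have hmI' : (m : ℤ) • I' = ν • I' := (units_smul_eq_natCast_smul₉ hν I').symm
  have hmem : (m : ℤ) • I' ∈ rightIdeals S.O := S.natCast_smul_mem₉ hm0 hI'
  have hle : (m : ℤ) • I' ≤ I := by
    intro x hx
    obtain ⟨y, hy, rfl⟩ := (Submodule.mem_smul_pointwise_iff_exists x _ I').mp hx
    exact hm y hy
  have hL' : leftOrder I = leftOrder ((m : ℤ) • I') := by rw [hmI', leftOrder_units_smul_of_val_eq_natCast₉ hν, hL]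
  obtain ⟨c, hc, L, hLq, h⟩ := S.exists_eq_smul_mul_prod_twoSided_of_leftOrder_eq_of_le hI hmem hL' hle
  exact ⟨m, c, hm0, hc, L, hLq, h⟩

/-! ## §4 On classes: the fibres of `typeOf` are the orbits of the Atkin–Lehner involutions -/

/-- **`[I T₁ ⋯ T_s]` is reached from `[I]` by the involutions `W_{q⁻}`, `W_{p⁺}`.** [cite: VignerasLNM800, Ch. III §5 exercice 5.8 (b)–(c)] [cite: Voight2021, (23.4.20)] -/
theorem XiSetup.reflTransGen_atkinLehner_mk_mul_prod (I : rightIdeals S.O) {L : List (Submodule ℤ S.D)}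
    (hL : ∀ T ∈ L, (∃ q : ℕ, q.Prime ∧ q ∣ Nminus ∧ T = normPrimeIdeal S.O q) ∨
      (∃ p : ℕ, p.Prime ∧ ¬ p ∣ Nminus ∧ T = atkinLehnerIdeal S.O (p ^ Nplus.factorization p))) :
    Relation.ReflTransGen
      (fun a b : ClassSet S.O =>
        (∃ (q : ℕ) (_ : Fact q.Prime) (hq : q ∣ Nminus), S.wMinus q hq a = b) ∨
          (∃ (p : ℕ) (_ : Fact p.Prime) (hp : ¬ p ∣ Nminus), S.wPlus p hp a = b))
      (Quotient.mk (rightClassSetoid S.O) I)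
      (Quotient.mk (rightClassSetoid S.O) ⟨(I : Submodule ℤ S.D) * L.prod, S.mul_prod_twoSided_mem I.2 hL⟩) := by
  induction L generalizing I with
  | nil =>
    have e : (Quotient.mk (rightClassSetoid S.O) ⟨(I : Submodule ℤ S.D) * ([] : List (Submodule ℤ S.D)).prod,
        S.mul_prod_twoSided_mem I.2 hL⟩ : ClassSet S.O) = Quotient.mk (rightClassSetoid S.O) I :=
      mk_congr₉ S _ I.2 (by simp)
    rw [e]
  | cons T L ih =>
    have hL' : ∀ T' ∈ L, _ := fun T' hT' => hL T' (List.mem_cons_of_mem T hT')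
    have hIT : (I : Submodule ℤ S.D) * T ∈ rightIdeals S.O := S.mul_prod_twoSided_mem (L := [T]) I.2 (by simpa using hL T (by simp))
      |> fun h => by simpa using h
    have step : Relation.ReflTransGen
        (fun a b : ClassSet S.O =>
          (∃ (q : ℕ) (_ : Fact q.Prime) (hq : q ∣ Nminus), S.wMinus q hq a = b) ∨
            (∃ (p : ℕ) (_ : Fact p.Prime) (hp : ¬ p ∣ Nminus), S.wPlus p hp a = b))
        (Quotient.mk (rightClassSetoid S.O) I) (Quotient.mk (rightClassSetoid S.O) ⟨_, hIT⟩) := by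
      refine Relation.ReflTransGen.single ?_
      rcases hL T (by simp) with ⟨q, hq, hqN, hT⟩ | ⟨p, hp, hpN, hT⟩
      · subst hT
        haveI : Fact q.Prime := ⟨hq⟩
        exact Or.inl ⟨q, inferInstance, hqN, S.wMinus_mk hqN I⟩
      · subst hT
        haveI : Fact p.Prime := ⟨hp⟩
        exact Or.inr ⟨p, inferInstance, hpN, S.wPlus_mk hpN I⟩
    have e : (Quotient.mk (rightClassSetoid S.O) ⟨(I : Submodule ℤ S.D) * (T :: L).prod, S.mul_prod_twoSided_mem I.2 hL⟩ :
        ClassSet S.O) =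
        Quotient.mk (rightClassSetoid S.O) ⟨(I : Submodule ℤ S.D) * T * L.prod, S.mul_prod_twoSided_mem hIT hL'⟩ :=
      mk_congr₉ S _ _ (by rw [List.prod_cons, mul_assoc])
    rw [e]
    exact step.trans (ih ⟨_, hIT⟩ hL')

/-- **Reachable classes have the same type**: `W_{q⁻}` and `W_{p⁺}` preserve `typeOf`. [cite: Voight2021, Remark 17.4.15 and (23.4.20)] -/
theorem XiSetup.typeOf_eq_of_reflTransGen_atkinLehner {c c' : ClassSet S.O}
    (h : Relation.ReflTransGen
      (fun a b : ClassSet S.O =>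
        (∃ (q : ℕ) (_ : Fact q.Prime) (hq : q ∣ Nminus), S.wMinus q hq a = b) ∨
          (∃ (p : ℕ) (_ : Fact p.Prime) (hp : ¬ p ∣ Nminus), S.wPlus p hp a = b)) c c') :
    typeOf S.O c' = typeOf S.O c := by
  induction h with
  | refl => rfl
  | tail _ hbc ih =>
    rcases hbc with ⟨q, hf, hq, rfl⟩ | ⟨p, hf, hp, rfl⟩
    · rw [S.typeOf_wMinus hq, ih]
    · rw [S.typeOf_wPlus hp, ih]

/-- Translating `I` translates `I T₁ ⋯ T_s`. [folklore] -/
private theorem units_smul_mul₉ (β : S.Dˣ) (I T : Submodule ℤ S.D) : (β • I) * T = β • (I * T) :=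
  smul_mul_assoc β I T

/-- **Classes with conjugate left orders, representative form** (Eichler orders): if `typeOf c' = typeOf c` then
`c' = [I_c T₁ ⋯ T_s]` for admissible two-sided ideals `Tᵢ`. [cite: Voight2021, Prop. 18.5.10 and (23.4.20)] -/
theorem XiSetup.exists_eq_mk_rep_mul_prod_twoSided_of_typeOf_eq {c c' : ClassSet S.O} (h : typeOf S.O c' = typeOf S.O c) :
    ∃ (L : List (Submodule ℤ S.D)) (hL : ∀ T ∈ L, (∃ q : ℕ, q.Prime ∧ q ∣ Nminus ∧ T = normPrimeIdeal S.O q) ∨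
        (∃ p : ℕ, p.Prime ∧ ¬ p ∣ Nminus ∧ T = atkinLehnerIdeal S.O (p ^ Nplus.factorization p))),
      c' = Quotient.mk (rightClassSetoid S.O) ⟨c.rep * L.prod, S.mul_prod_twoSided_mem c.rep_mem hL⟩ := by
  obtain ⟨β, hβ⟩ := typeOf_eq_typeOf_iff.mp h.symm
  have hI : β • c.rep ∈ rightIdeals S.O :=
    S.mem_rightIdeals_of_isInvertibleRightIdeal (IsInvertibleRightIdeal.units_smul β (S.isInvertibleRightIdeal_of_mem c.rep_mem))
  have hL : leftOrder (β • c.rep) = leftOrder c'.rep := by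
    rw [hβ]
    exact leftOrderOf_units_smul β c.rep
  obtain ⟨m, k, hm, hk, L, hLq, hcase⟩ := S.exists_smul_eq_smul_mul_prod_twoSided_of_leftOrder_eq hI c'.rep_mem hL
  have hmI' : (m : ℤ) • c'.rep ∈ rightIdeals S.O := S.natCast_smul_mem₉ hm c'.rep_mem
  have hc' : c' = Quotient.mk (rightClassSetoid S.O) ⟨(m : ℤ) • c'.rep, hmI'⟩ := by
    rw [mk_natCast_smul_eq₉ S hm c'.rep_mem hmI', ClassSet.mk_rep]
  have hP : β • c.rep * L.prod ∈ rightIdeals S.O := S.mul_prod_twoSided_mem hI hLq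
  have hkP : (k : ℤ) • (β • c.rep * L.prod) ∈ rightIdeals S.O := hcase ▸ hmI'
  have hP' : c.rep * L.prod ∈ rightIdeals S.O := S.mul_prod_twoSided_mem c.rep_mem hLq
  have hbP : β • (c.rep * L.prod) ∈ rightIdeals S.O := (units_smul_mul₉ S β _ _) ▸ hP
  refine ⟨L, hLq, ?_⟩
  rw [hc', mk_congr₉ S hmI' hkP hcase, mk_natCast_smul_eq₉ S hk hP hkP, mk_congr₉ S hP hbP (units_smul_mul₉ S β _ _),
    mk_units_smul_eq₉ S β hP' hbP]

/-- **THE FIBRES OF THE TYPE MAP OF AN EICHLER ORDER ARE THE ORBITS OF ITS ATKIN–LEHNER INVOLUTIONS**: for every Brandt setup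
of type `(N⁺, N⁻)`, `typeOf c' = typeOf c` — the left orders `O_L(I_{c'})`, `O_L(I_c)` (Eichler orders of level `N⁺`) are
conjugate — iff `c'` is obtained from `c` by a finite sequence of the involutions `W_{q⁻} : [I] ↦ [I 𝔓_q]` (`q ∣ N⁻`) and
`W_{p⁺} : [I] ↦ [I 𝔔_{p^{v_p N⁺}}]` (`p ∤ N⁻`). Voight (23.4.20) with Prop. 18.5.10: the fibres are the `PIdl(O') \ Idl(O')`-
torsors, `Idl(O')/Idl(ℤ) ≃ ∏_{p ∣ N⁺N⁻} ℤ/2ℤ`. [cite: Voight2021, Prop. 18.5.10 and (23.4.20)] [cite: VignerasLNM800, Ch. III §5 exercice 5.8] -/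
theorem XiSetup.typeOf_eq_typeOf_iff_reflTransGen_atkinLehner {c c' : ClassSet S.O} :
    typeOf S.O c' = typeOf S.O c ↔
      Relation.ReflTransGen
        (fun a b : ClassSet S.O =>
          (∃ (q : ℕ) (_ : Fact q.Prime) (hq : q ∣ Nminus), S.wMinus q hq a = b) ∨
            (∃ (p : ℕ) (_ : Fact p.Prime) (hp : ¬ p ∣ Nminus), S.wPlus p hp a = b)) c c' := by
  refine ⟨fun h => ?_, S.typeOf_eq_of_reflTransGen_atkinLehner⟩
  obtain ⟨L, hL, rfl⟩ := S.exists_eq_mk_rep_mul_prod_twoSided_of_typeOf_eq h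
  have hreach := S.reflTransGen_atkinLehner_mk_mul_prod ⟨c.rep, c.rep_mem⟩ hL
  rwa [ClassSet.mk_rep] at hreach

/-- **The type of `[I_c T₁ ⋯ T_s]` is the type of `c`.** [cite: Voight2021, Remark 17.4.15 and (23.4.20)] -/
theorem XiSetup.typeOf_mk_rep_mul_prod_twoSided (c : ClassSet S.O) {L : List (Submodule ℤ S.D)}
    (hL : ∀ T ∈ L, (∃ q : ℕ, q.Prime ∧ q ∣ Nminus ∧ T = normPrimeIdeal S.O q) ∨
      (∃ p : ℕ, p.Prime ∧ ¬ p ∣ Nminus ∧ T = atkinLehnerIdeal S.O (p ^ Nplus.factorization p))) :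
    typeOf S.O (Quotient.mk (rightClassSetoid S.O) ⟨c.rep * L.prod, S.mul_prod_twoSided_mem c.rep_mem hL⟩) = typeOf S.O c := by
  have h := S.reflTransGen_atkinLehner_mk_mul_prod ⟨c.rep, c.rep_mem⟩ hL
  rw [ClassSet.mk_rep] at h
  exact S.typeOf_eq_of_reflTransGen_atkinLehner h

/-- **The fibre of the type map through `c`, representative form** (Eichler orders): `typeOf c' = typeOf c` iff
`c' = [I_c T₁ ⋯ T_s]` for admissible two-sided ideals `Tᵢ`. [cite: Voight2021, Prop. 18.5.10 and (23.4.20)] -/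
theorem XiSetup.typeOf_eq_typeOf_iff_exists_eq_mk_rep_mul_prod_twoSided {c c' : ClassSet S.O} :
    typeOf S.O c' = typeOf S.O c ↔
      ∃ (L : List (Submodule ℤ S.D)) (hL : ∀ T ∈ L, (∃ q : ℕ, q.Prime ∧ q ∣ Nminus ∧ T = normPrimeIdeal S.O q) ∨
          (∃ p : ℕ, p.Prime ∧ ¬ p ∣ Nminus ∧ T = atkinLehnerIdeal S.O (p ^ Nplus.factorization p))),
        c' = Quotient.mk (rightClassSetoid S.O) ⟨c.rep * L.prod, S.mul_prod_twoSided_mem c.rep_mem hL⟩ := by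
  refine ⟨S.exists_eq_mk_rep_mul_prod_twoSided_of_typeOf_eq, ?_⟩
  rintro ⟨L, hL, rfl⟩
  exact S.typeOf_mk_rep_mul_prod_twoSided c hL

end Brandt

end Literature.NumberTheory.Automorphic
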